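import Literature.Combinatorics.Words.PrimitiveClassCount
import Mathlib.Order.Filter.AtTopBot.Basic
import HarnessLib

/-!
# Growth of the number of Lyndon words: `ψ_k(n) ≥ 1` and `ψ_k(n) → ∞` (`k ≥ 2`)

Lothaire, *Combinatorics on Words* (1997), §1.3 eq. (1.3.7) / §5.1 / Corollary 5.3.5 (**Witt's
formula**) [cite: Lothaire1997, §1.3 (eq. (1.3.7)); Cor 5.3.5]: the number `ψ_k(n)` of Lyndon words of
length `n` over a `k`-letter alphabet (equivalently, of conjugacy classes of primitive words of length `n`;
equivalently — Cor. 5.3.5 — the rank of the degree-`n` component of the free Lie algebra on `k` generators)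
is `ψ_k(n) = (1/n) Σ_{d ∣ n} μ(d) k^{n/d}`.  The tree already holds Witt's formula
(`Literature/Combinatorics/Words/PrimitiveClassCount.lean`:
`natCast_mul_card_primitiveConjClasses_eq_sum_moebius`, `card_lyndonWords_eq_sum_moebius_div`).

THIS PROOF-ONLY FILE (no definitions) adds the elementary GROWTH consequences of (1.3.7) that the
FRONTIER programme «REFUTE-F1732» (plan/L3/SUBDAG-SemiAnbd-Thm37iii-REFUTE.md, hypothesis (H6) «totally
elevated» of [SemiAnbd] Thm 3.7 for the countermodel `𝒢_θ`, brick R5; layer dimensions of the free pro-`p`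
group of rank two are sums of Witt numbers `ψ_2(i)` by Lazard's identification, cited there) consumes BY
NAME — brick **R2b** part 2, seat abc-iut-w6-d096:

* `sum_moebius_mul_pow_lower_bound` — the Möbius sum of (1.3.7) is at least `kⁿ − k^{⌊n/2⌋+1} + k`
  (`k ≥ 2`, `n ≥ 1`): the `d = 1` term is `kⁿ`, every other term is `≥ −k^{n/d}` (`|μ| ≤ 1`), and
  `Σ_{d ∣ n, d ≠ 1} k^{n/d} = Σ_{e ∣ n, e ≠ n} k^e ≤ Σ_{e=1}^{⌊n/2⌋} k^e ≤ k^{⌊n/2⌋+1} − k`;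
* `le_natCast_mul_card_lyndonWords` — hence `kⁿ − k^{⌊n/2⌋+1} + k ≤ n·ψ_k(n)`;
* `one_le_card_lyndonWords` — **`ψ_k(n) ≥ 1`** for every `n ≥ 1` when `k ≥ 2` (so partial sums
  `Σ_{i≤s} ψ_k(i) ≥ s`);
* `div_two_le_card_lyndonWords` — `⌊n/2⌋ ≤ ψ_k(n)` for `n ≥ 4`, and
  `tendsto_card_lyndonWords_atTop` — **`ψ_k(n) → ∞`**.

Mathlib + the tree's Lothaire file only; a Lean transcription of textbook consequences, no novelty
claimed; nothing here bears on [IUTchIII] Cor. 3.12.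
-/

namespace Literature.Combinatorics.Words

open Finset Filter
open scoped ArithmeticFunction.Moebius

/-! ### The Möbius sum of Witt's formula is at least `kⁿ − k^{⌊n/2⌋+1} + k` -/

/-- Geometric bound: `Σ_{e=1}^{m} k^e ≤ k^{m+1} − k` for `k ≥ 2`.
[cite: Lothaire1997, §1.3 (eq. (1.3.7))] -/
theorem sum_Icc_pow_le_pow_succ_sub {k : ℕ} (hk : 2 ≤ k) (m : ℕ) :
    ∑ e ∈ Icc 1 m, (k : ℤ) ^ e ≤ (k : ℤ) ^ (m + 1) - k := by
  induction m with
  | zero => simp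
  | succ m ih =>
    rw [sum_Icc_succ_top (Nat.le_add_left 1 m), pow_succ (k : ℤ) (m + 1)]
    have hk' : (2 : ℤ) ≤ k := by exact_mod_cast hk
    have hpos : (0 : ℤ) ≤ (k : ℤ) ^ (m + 1) := pow_nonneg (by positivity) _
    nlinarith

/-- A proper divisor `e` of `n` satisfies `e ≤ n/2`. [cite: Lothaire1997, §1.3 (eq. (1.3.6))] -/
theorem le_div_two_of_mem_properDivisors {n e : ℕ} (he : e ∈ n.properDivisors) : e ≤ n / 2 := by
  obtain ⟨⟨c, rfl⟩, hlt⟩ := Nat.mem_properDivisors.mp he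
  have hc : 2 ≤ c := by
    by_contra h
    have hc1 : c ≤ 1 := by omega
    have : e * c ≤ e * 1 := Nat.mul_le_mul_left e hc1
    omega
  exact (Nat.le_div_iff_mul_le two_pos).mpr (Nat.mul_le_mul_left e hc)

/-- `Σ_{d ∣ n} k^{n/d}`, reindexed by `e = n/d`, minus the `e = n` term: the sum of `k^e` over the proper
divisors `e` of `n` equals `Σ_{d ∣ n} k^{n/d} − kⁿ` (`n ≥ 1`). [cite: Lothaire1997, §1.3 (eq. (1.3.6))] -/
theorem sum_divisors_pow_div_eq {k n : ℕ} (hn : 0 < n) :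
    ∑ d ∈ n.divisors, (k : ℤ) ^ (n / d) = (k : ℤ) ^ n + ∑ e ∈ n.properDivisors, (k : ℤ) ^ e := by
  rw [Nat.sum_div_divisors n (fun e => (k : ℤ) ^ e), ← Nat.insert_self_properDivisors hn.ne',
    sum_insert Nat.self_notMem_properDivisors]

/-- **Lower bound for the Möbius sum of Witt's formula (1.3.7)**: for `k ≥ 2` and `n ≥ 1`,
`kⁿ − k^{⌊n/2⌋+1} + k ≤ Σ_{d ∣ n} μ(d) k^{n/d}`. [cite: Lothaire1997, §1.3 (eq. (1.3.7)); Cor 5.3.5] -/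
theorem sum_moebius_mul_pow_lower_bound {k : ℕ} (hk : 2 ≤ k) {n : ℕ} (hn : 0 < n) :
    (k : ℤ) ^ n - (k : ℤ) ^ (n / 2 + 1) + k ≤ ∑ d ∈ n.divisors, (μ d : ℤ) * (k : ℤ) ^ (n / d) := by
  -- split off the term `d = 1`
  have h1 : (1 : ℕ) ∈ n.divisors := Nat.one_mem_divisors.mpr hn.ne'
  rw [← add_sum_erase _ _ h1, ArithmeticFunction.moebius_apply_one, Nat.div_one, one_mul]
  -- every other term is at least `−k^{n/d}`
  have hterm : ∀ d ∈ n.divisors.erase 1, -((k : ℤ) ^ (n / d)) ≤ (μ d : ℤ) * (k : ℤ) ^ (n / d) := by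
    intro d _
    have hμ : (-1 : ℤ) ≤ μ d := (abs_le.mp ArithmeticFunction.abs_moebius_le_one).1
    have hpow : (0 : ℤ) ≤ (k : ℤ) ^ (n / d) := pow_nonneg (by positivity) _
    nlinarith
  have hsum : -(∑ d ∈ n.divisors.erase 1, (k : ℤ) ^ (n / d)) ≤
      ∑ d ∈ n.divisors.erase 1, (μ d : ℤ) * (k : ℤ) ^ (n / d) := by
    rw [← sum_neg_distrib]
    exact sum_le_sum hterm
  -- and `Σ_{d ∣ n, d ≠ 1} k^{n/d} = Σ_{e ∣ n, e ≠ n} k^e ≤ Σ_{e=1}^{⌊n/2⌋} k^e ≤ k^{⌊n/2⌋+1} − k`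
  have herase : ∑ d ∈ n.divisors.erase 1, (k : ℤ) ^ (n / d) = ∑ e ∈ n.properDivisors, (k : ℤ) ^ e := by
    have h := add_sum_erase n.divisors (fun d => (k : ℤ) ^ (n / d)) h1
    rw [Nat.div_one, sum_divisors_pow_div_eq hn] at h
    linarith
  have hproper : ∑ e ∈ n.properDivisors, (k : ℤ) ^ e ≤ ∑ e ∈ Icc 1 (n / 2), (k : ℤ) ^ e := by
    refine sum_le_sum_of_subset_of_nonneg (fun e he => ?_) fun _ _ _ => pow_nonneg (by positivity) _
    rw [mem_Icc]
    exact ⟨Nat.pos_of_mem_properDivisors he, le_div_two_of_mem_properDivisors he⟩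
  have hgeom := sum_Icc_pow_le_pow_succ_sub hk (n / 2)
  linarith [hsum, herase ▸ hproper]

/-! ### Consequences for `ψ_k(n) = Card(L ∩ Aⁿ)` -/

section Lyndon

variable {α : Type*} [LinearOrder α] [Fintype α]

/-- **`kⁿ − k^{⌊n/2⌋+1} + k ≤ n·ψ_k(n)`** (`k = Card(A) ≥ 2`, `n ≥ 1`), from Witt's formula (1.3.7)
`n·ψ_k(n) = Σ_{d ∣ n} μ(d) k^{n/d}` (tree: `natCast_mul_card_primitiveConjClasses_eq_sum_moebius`) and the
lower bound for the Möbius sum. [cite: Lothaire1997, §1.3 (eq. (1.3.7)); §5.1] -/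
theorem le_natCast_mul_card_lyndonWords (hk : 2 ≤ Fintype.card α) {n : ℕ} (hn : 0 < n) :
    (Fintype.card α : ℤ) ^ n - (Fintype.card α : ℤ) ^ (n / 2 + 1) + Fintype.card α ≤
      (n : ℤ) * (lyndonWords α n).card := by
  rw [← card_primitiveConjClasses, natCast_mul_card_primitiveConjClasses_eq_sum_moebius hn]
  exact sum_moebius_mul_pow_lower_bound hk hn

/-- In particular `k ≤ n·ψ_k(n)` (`k ≥ 2`, `n ≥ 1`), since `k^{⌊n/2⌋+1} ≤ kⁿ`.
[cite: Lothaire1997, §1.3 (eq. (1.3.7)); §5.1] -/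
theorem card_le_natCast_mul_card_lyndonWords (hk : 2 ≤ Fintype.card α) {n : ℕ} (hn : 0 < n) :
    (Fintype.card α : ℤ) ≤ (n : ℤ) * (lyndonWords α n).card := by
  have h := le_natCast_mul_card_lyndonWords hk hn
  have hpow : (Fintype.card α : ℤ) ^ (n / 2 + 1) ≤ (Fintype.card α : ℤ) ^ n :=
    pow_le_pow_right₀ (by exact_mod_cast (by omega : 1 ≤ Fintype.card α)) (by omega)
  linarith

/-- **`ψ_k(n) ≥ 1`: over an alphabet with at least two letters there is a Lyndon word of every length
`n ≥ 1`** (so the partial sums `Σ_{i ≤ s} ψ_k(i)` are `≥ s`). [cite: Lothaire1997, §5.1 (Card(L ∩ Aⁿ))] -/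
theorem one_le_card_lyndonWords (hk : 2 ≤ Fintype.card α) {n : ℕ} (hn : 0 < n) :
    1 ≤ (lyndonWords α n).card := by
  have h := card_le_natCast_mul_card_lyndonWords hk hn
  have hk' : (2 : ℤ) ≤ Fintype.card α := by exact_mod_cast hk
  by_contra h0
  have hz : (lyndonWords α n).card = 0 := by omega
  rw [hz, Nat.cast_zero, mul_zero] at h
  linarith

/-- The set of Lyndon words of length `n ≥ 1` is non-empty (`k ≥ 2`). [cite: Lothaire1997, §5.1 (Card(L ∩ Aⁿ))] -/
theorem lyndonWords_nonempty (hk : 2 ≤ Fintype.card α) {n : ℕ} (hn : 0 < n) :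
    (lyndonWords α n).Nonempty :=
  card_pos.mp (one_le_card_lyndonWords hk hn)

/-- Auxiliary: `n² ≤ 2ⁿ` for `n ≥ 4` (private copy; the same inequality is
`Literature.Computability.Complexity.KabanetsCai.sq_le_two_pow`, not imported here to keep the
combinatorics-on-words import closure small). [folklore] -/
private theorem sq_le_two_pow_of_four_le {n : ℕ} (hn : 4 ≤ n) : n * n ≤ 2 ^ n := by
  induction n, hn using Nat.le_induction with
  | base => norm_num
  | succ m hm ih =>
    have h3 : 2 * m + 1 ≤ m * m := by nlinarith
    calc (m + 1) * (m + 1) = m * m + (2 * m + 1) := by ring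
      _ ≤ 2 ^ m + 2 ^ m := Nat.add_le_add ih (h3.trans ih)
      _ = 2 ^ (m + 1) := by ring

/-- **`⌊n/2⌋ ≤ ψ_k(n)` for `n ≥ 4`** (`k ≥ 2`): from `n·ψ_k(n) ≥ kⁿ − k^{⌊n/2⌋+1} ≥ kⁿ/2 ≥ 2^{n−1}` and
`n² ≤ 2ⁿ`. [cite: Lothaire1997, §1.3 (eq. (1.3.7)); §5.1] -/
theorem div_two_le_card_lyndonWords (hk : 2 ≤ Fintype.card α) {n : ℕ} (hn : 4 ≤ n) :
    n / 2 ≤ (lyndonWords α n).card := by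
  set k : ℕ := Fintype.card α with hkdef
  have hn0 : 0 < n := by omega
  have h := le_natCast_mul_card_lyndonWords hk hn0
  rw [← hkdef] at h
  have hk1 : (1 : ℤ) ≤ k := by exact_mod_cast (by omega : 1 ≤ k)
  have hk2 : (2 : ℤ) ≤ k := by exact_mod_cast hk
  -- `2·k^{⌊n/2⌋+1} ≤ k^{⌊n/2⌋+2} ≤ kⁿ`
  have hA : 2 * (k : ℤ) ^ (n / 2 + 1) ≤ (k : ℤ) ^ n := by
    calc 2 * (k : ℤ) ^ (n / 2 + 1) ≤ (k : ℤ) * (k : ℤ) ^ (n / 2 + 1) :=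
          mul_le_mul_of_nonneg_right hk2 (pow_nonneg (by positivity) _)
      _ = (k : ℤ) ^ (n / 2 + 2) := by ring
      _ ≤ (k : ℤ) ^ n := pow_le_pow_right₀ hk1 (by omega)
  -- `2^n ≤ k^n`
  have hB : (2 : ℤ) ^ n ≤ (k : ℤ) ^ n := pow_le_pow_left₀ (by norm_num) hk2 n
  -- `n² ≤ 2^n`
  have hC : ((n * n : ℕ) : ℤ) ≤ ((2 ^ n : ℕ) : ℤ) := by exact_mod_cast sq_le_two_pow_of_four_le hn
  push_cast at hC
  -- so `2·n·ψ ≥ kⁿ ≥ 2ⁿ ≥ n²`, i.e. `2ψ ≥ n`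
  have hD : (n : ℤ) * n ≤ 2 * ((n : ℤ) * (lyndonWords α n).card) := by nlinarith
  have hE : (n : ℤ) ≤ 2 * ((lyndonWords α n).card : ℤ) := by
    have hnpos : (0 : ℤ) < n := by exact_mod_cast hn0
    nlinarith
  have hE' : n ≤ 2 * (lyndonWords α n).card := by exact_mod_cast hE
  omega

/-- **`ψ_k(n) → ∞`** as `n → ∞`, for an alphabet with at least two letters (Witt's formula gives
`ψ_k(n) ~ kⁿ/n`; here the crude bound `ψ_k(n) ≥ ⌊n/2⌋` for `n ≥ 4` suffices).
[cite: Lothaire1997, §1.3 (eq. (1.3.7)); Cor 5.3.5] -/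
theorem tendsto_card_lyndonWords_atTop (hk : 2 ≤ Fintype.card α) :
    Tendsto (fun n => (lyndonWords α n).card) atTop atTop := by
  refine tendsto_atTop_atTop.2 fun b => ⟨2 * b + 4, fun n hn => ?_⟩
  have h := div_two_le_card_lyndonWords hk (by omega : 4 ≤ n)
  omega

end Lyndon

end Literature.Combinatorics.Words
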